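import Literature.AlgebraicGeometry.ModuliOfAbelianVarieties.SiegelComplexRecordSystem
import Literature.GroupTheory.ArithmeticGroups.IsometryCongruenceRigidity
import Mathlib.Analysis.Matrix.PosDef
import HarnessLib

/-!
# Principal levels `K_δ(N)`, `N ≥ 3`, act freely on `Sh_{K_δ(N′)}(GSp_δ, S^±)(ℂ)` ([Deligne 1971] 1.15, freeness step)

Topic `AlgebraicGeometry/ModuliOfAbelianVarieties`; namespace `Literature.AlgebraicGeometry.ModuliOfAbelianVarieties`
(as the (σ1)–(σ3) files).  Theorems only (no definition, no named fact, no `sorry`).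

For `N ≥ 3`, `N ∣ N′`, `κ ∈ K_δ(N)` and a point `[J, a]` of the Siegel Shimura set at principal level `K_δ(N′)`
(`SiegelShimuraSet δ (principalLevelSubgroup δ N′)`, (σ2)/(σ3)): if `[J, a κ] = [J, a]` then `κ ∈ K_δ(N′)` — the finite
group `K_δ(N)/K_δ(N′)` acts FREELY.  Proof ([Milne2005ShimuraVarieties] proof of Thm. 5.17 / Prop. 3.5 with the
compactness–discreteness step replaced by a characteristic-polynomial argument): an equality of classes gives
`γ ∈ GSp_δ(ℚ)` with `γ J γ⁻¹ = J` and `a⁻¹ γ a ∈ κ K_δ(N′) ⊆ K_δ(N)`; then (§1) `det γ = ±1` and the characteristic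
polynomial of `(γ - 1)/N` has INTEGER coefficients (it is conjugate in `GL_{2g}(𝔸_f)` to an integral adelic matrix and
`ℚ ∩ ℤ̂ = ℤ`), the multiplier of `γ` is `1` (§2: `ν > 0` from the definite form `ᵗJ E_δ`, `ν^{2g} = det γ² = 1`), so `γ`
is a rational ISOMETRY of the positive definite `±ᵗJ E_δ` with `charpoly((γ-1)/N) ∈ ℤ[X]`, hence `γ = 1` by
★ `ArithmeticGroups.eq_one_of_isometry_of_charpoly_integral`; and `γ = 1` forces `κ ∈ K_δ(N′)`.

* §1 `exists_int_cast_eq_of_algebraMap_mem_integralAdeles` (`ℚ ∩ ℤ̂ = ℤ`), `exists_monic_map_eq_charpoly_of_isCongOne`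
  (integrality of `charpoly((γ-1)/N)`), `det_eq_one_or_eq_neg_one_of_isCongOne`;
* §2 `mem_principalLevelSubgroup_of_mk_mul_eq_mk` — **the freeness theorem**.

Cell hodgecm-mathlib, row I-1′ `F1ExtHodgeType` v4, `stub_S2inj` Step B3 = leaf Q3 of `B-plan/I1prime-RECEPTACLE-PLAN.md`
§7.4.  HC_CM is proved only modulo the 7 printed citations until rung 0 closes; this file proves no cell binder.

## References
* [Deligne1971TravauxShimura] P. Deligne, *Travaux de Shimura* (1971), Prop. 1.15 p. 132, Exemple 4.16 p. 150.
* [Milne2005ShimuraVarieties] J. S. Milne, *Introduction to Shimura Varieties* (2005), Prop. 3.5, Thm. 5.17 (proof),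
  §6 p. 70.
-/

noncomputable section

open Matrix Polynomial IsDedekindDomain NumberField
open Literature.GroupTheory.ArithmeticGroups

namespace Literature.AlgebraicGeometry.ModuliOfAbelianVarieties

open SiegelModuli

variable {g : ℕ}

/-! ### §1. Adelic integrality: `ℚ ∩ ℤ̂ = ℤ`, integrality of `det` and of `charpoly((γ-1)/N)` -/

/-- **`ℚ ∩ ℤ̂ = ℤ`**: a rational number which is an integral finite adele is an integer.
[cite: Deligne1971TravauxShimura, 0.4 p. 125] -/
theorem exists_int_cast_eq_of_algebraMap_mem_integralAdeles {x : ℚ}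
    (hx : algebraMap ℚ finAdeleQ x ∈ FiniteAdeleRing.integralAdeles (𝓞 ℚ) ℚ) : ∃ z : ℤ, (z : ℚ) = x := by
  obtain ⟨y, hy⟩ := hx
  have hval : ∀ v : HeightOneSpectrum (𝓞 ℚ), v.valuation ℚ x ≤ 1 := by
    intro v
    have h1 : (FiniteAdeleRing.structureMap (𝓞 ℚ) ℚ y) v = (algebraMap ℚ finAdeleQ x) v := by rw [hy]
    simp only [FiniteAdeleRing.structureMap_apply_apply, FiniteAdeleRing.algebraMap_apply] at h1
    have h2 : Valued.v ((y v : v.adicCompletion ℚ)) ≤ 1 := (y v).2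
    rw [h1] at h2
    rw [← HeightOneSpectrum.valuedAdicCompletion_eq_valuation']
    exact h2
  obtain ⟨r, hr⟩ := HeightOneSpectrum.mem_integers_of_valuation_le_one ℚ x hval
  refine ⟨Rat.ringOfIntegersEquiv r, ?_⟩
  rw [Rat.ringOfIntegersEquiv_apply_coe, ← hr]

variable {n : Type} [Fintype n] [DecidableEq n]

omit [Fintype n] in
/-- An adelic matrix `≡ 1 (mod N·ℤ̂)` is `1 + N·A` with `A` integral. [cite: Deligne1971TravauxShimura, Exemple 4.16 p. 150] -/
theorem exists_eq_one_add_smul_of_isCongOne {N : ℕ} {m : Matrix n n finAdeleQ} (hm : IsCongOne N m) :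
    ∃ A : Matrix n n finAdeleQ, (∀ i j, A i j ∈ FiniteAdeleRing.integralAdeles (𝓞 ℚ) ℚ) ∧ m = 1 + (N : finAdeleQ) • A := by
  choose y hy hyeq using fun i j => mem_levelIdeal_iff.1 (hm i j)
  refine ⟨fun i j => y i j, fun i j => hy i j, ?_⟩
  ext i j
  have h : (N : finAdeleQ) * y i j = m i j - (1 : Matrix n n finAdeleQ) i j := by
    rw [← Matrix.sub_apply]; exact hyeq i j
  rw [Matrix.add_apply, Matrix.smul_apply, smul_eq_mul, sub_eq_iff_eq_add.1 h.symm, add_comm]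

omit [Fintype n] in
/-- An adelic matrix `≡ 1 (mod N·ℤ̂)` has integral entries. [cite: Deligne1971TravauxShimura, Exemple 4.16 p. 150] -/
theorem mem_integralAdeles_of_isCongOne {N : ℕ} {m : Matrix n n finAdeleQ} (hm : IsCongOne N m) (i j : n) :
    m i j ∈ FiniteAdeleRing.integralAdeles (𝓞 ℚ) ℚ := by
  have h : m i j = (m - 1) i j + (1 : Matrix n n finAdeleQ) i j := by rw [Matrix.sub_apply, sub_add_cancel]
  rw [h]
  refine add_mem (mem_integralAdeles_of_mem_levelIdeal (hm i j)) ?_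
  rw [Matrix.one_apply]
  split_ifs
  · exact one_mem _
  · exact zero_mem _

/-- The characteristic polynomial of a matrix with integral adelic entries has integral coefficients. [folklore] -/
private theorem coeff_charpoly_mem_integralAdeles {A : Matrix n n finAdeleQ}
    (hA : ∀ i j, A i j ∈ FiniteAdeleRing.integralAdeles (𝓞 ℚ) ℚ) (k : ℕ) :
    A.charpoly.coeff k ∈ FiniteAdeleRing.integralAdeles (𝓞 ℚ) ℚ := by
  -- `A` comes from a matrix over the subring
  set A₀ : Matrix n n (FiniteAdeleRing.integralAdeles (𝓞 ℚ) ℚ) := fun i j => ⟨A i j, hA i j⟩ with hA₀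
  have hmap : A = A₀.map (Subring.subtype _) := by ext i j; rfl
  rw [hmap, Matrix.charpoly_map, Polynomial.coeff_map]
  exact (A₀.charpoly.coeff k).2

/-- The determinant of a matrix with integral adelic entries is integral. [folklore] -/
private theorem det_mem_integralAdeles {A : Matrix n n finAdeleQ}
    (hA : ∀ i j, A i j ∈ FiniteAdeleRing.integralAdeles (𝓞 ℚ) ℚ) :
    A.det ∈ FiniteAdeleRing.integralAdeles (𝓞 ℚ) ℚ := by
  set A₀ : Matrix n n (FiniteAdeleRing.integralAdeles (𝓞 ℚ) ℚ) := fun i j => ⟨A i j, hA i j⟩ with hA₀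
  have hmap : A = A₀.map (Subring.subtype _) := by ext i j; rfl
  rw [hmap, ← RingHom.mapMatrix_apply, ← RingHom.map_det]
  exact (A₀.det).2

set_option maxHeartbeats 800000 in
/-- **Integrality of `charpoly((γ - 1)/N)` for `γ ∈ GL_n(ℚ)` adelically conjugate into level `N`**: if for some
`a ∈ GL_n(𝔸_f)` the matrix `a⁻¹ γ a` is `≡ 1 (mod N·ℤ̂)` (`N ≥ 1`), then the characteristic polynomial of
`N⁻¹ (γ - 1) ∈ M_n(ℚ)` is (the image of) a MONIC INTEGER polynomial.
[cite: Deligne1971TravauxShimura, Exemple 4.16 p. 150 and proof of Prop. 1.15 p. 132] -/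
theorem exists_monic_map_eq_charpoly_of_isCongOne {N : ℕ} (hN : N ≠ 0) (γ : GL n ℚ) (a : GL n finAdeleQ)
    (hm : IsCongOne N ((a⁻¹ * Matrix.GeneralLinearGroup.map (algebraMap ℚ finAdeleQ) γ * a : GL n finAdeleQ) :
      Matrix n n finAdeleQ)) :
    ∃ P : ℤ[X], P.Monic ∧ P.map (Int.castRingHom ℚ) = (((N : ℚ)⁻¹ • ((γ : Matrix n n ℚ) - 1))).charpoly := by
  set f := algebraMap ℚ finAdeleQ with hf
  set B : Matrix n n ℚ := (N : ℚ)⁻¹ • ((γ : Matrix n n ℚ) - 1) with hB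
  -- the conjugate `A = a⁻¹ B_𝔸 a = N⁻¹ (a⁻¹ γ a - 1)` has integral entries
  obtain ⟨A, hAint, hmA⟩ := exists_eq_one_add_smul_of_isCongOne hm
  have hNinv : f ((N : ℚ)⁻¹) * (N : finAdeleQ) = 1 := by
    rw [← map_natCast f N, ← map_mul, inv_mul_cancel₀ (by exact_mod_cast hN : (N : ℚ) ≠ 0), map_one]
  have hmapγ : ((Matrix.GeneralLinearGroup.map f γ : GL n finAdeleQ) : Matrix n n finAdeleQ) = (γ : Matrix n n ℚ).map f :=
    Matrix.ext fun i j => Matrix.GeneralLinearGroup.map_apply f i j γ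
  have hconj : (a : Matrix n n finAdeleQ)⁻¹ * B.map f * (a : Matrix n n finAdeleQ) = A := by
    have h1 : (a : Matrix n n finAdeleQ)⁻¹ * ((γ : Matrix n n ℚ).map f) * (a : Matrix n n finAdeleQ) =
        1 + (N : finAdeleQ) • A := by
      rw [← hmA, Units.val_mul, Units.val_mul, Matrix.coe_units_inv, hmapγ]
    have h2 : B.map f = f ((N : ℚ)⁻¹) • (((γ : Matrix n n ℚ).map f) - 1) := by
      ext i j
      simp only [hB, Matrix.map_apply, Matrix.smul_apply, Matrix.sub_apply, smul_eq_mul, map_mul, map_sub,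
        Matrix.one_apply]
      split_ifs <;> simp
    rw [h2, Matrix.mul_smul, Matrix.smul_mul, Matrix.mul_sub, Matrix.sub_mul, Matrix.mul_one, h1,
      Matrix.nonsing_inv_mul _ (Matrix.isUnits_det_units a), add_sub_cancel_left, smul_smul, hNinv, one_smul]
  -- hence `charpoly B` has integral adelic coefficients
  have hcoeff : ∀ k, f (B.charpoly.coeff k) ∈ FiniteAdeleRing.integralAdeles (𝓞 ℚ) ℚ := by
    intro k
    have h1 : (B.map f).charpoly = A.charpoly := by
      rw [← hconj]
      exact (Matrix.charpoly_units_conj' a (B.map f)).symm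
    have h2 : f (B.charpoly.coeff k) = (B.map f).charpoly.coeff k := by
      rw [Matrix.charpoly_map, Polynomial.coeff_map]
    rw [h2, h1]
    exact coeff_charpoly_mem_integralAdeles hAint k
  -- so it lifts to a monic integer polynomial
  have hlifts : B.charpoly ∈ Polynomial.lifts (Int.castRingHom ℚ) := by
    rw [Polynomial.lifts_iff_coeff_lifts]
    intro k
    obtain ⟨z, hz⟩ := exists_int_cast_eq_of_algebraMap_mem_integralAdeles (hcoeff k)
    exact ⟨z, by simpa using hz⟩
  obtain ⟨P, hPmap, -, hPmonic⟩ := Polynomial.lifts_and_natDegree_eq_and_monic hlifts (Matrix.charpoly_monic B)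
  exact ⟨P, hPmonic, hPmap⟩

/-- `det (a⁻¹ γ_𝔸 a) = det γ` (as finite adeles). [folklore] -/
private theorem det_conj_map (γ : GL n ℚ) (a : GL n finAdeleQ) :
    ((a⁻¹ * Matrix.GeneralLinearGroup.map (algebraMap ℚ finAdeleQ) γ * a : GL n finAdeleQ) : Matrix n n finAdeleQ).det =
      algebraMap ℚ finAdeleQ (γ : Matrix n n ℚ).det := by
  rw [Units.val_mul, Units.val_mul, Matrix.det_mul, Matrix.det_mul, mul_comm, ← mul_assoc, ← Matrix.det_mul,
    Matrix.coe_units_inv, Matrix.mul_nonsing_inv _ (Matrix.isUnits_det_units a), Matrix.det_one, one_mul]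
  have hmapγ : ((Matrix.GeneralLinearGroup.map (algebraMap ℚ finAdeleQ) γ : GL n finAdeleQ) : Matrix n n finAdeleQ) =
      (γ : Matrix n n ℚ).map (algebraMap ℚ finAdeleQ) :=
    Matrix.ext fun i j => Matrix.GeneralLinearGroup.map_apply (algebraMap ℚ finAdeleQ) i j γ
  rw [hmapγ, ← RingHom.mapMatrix_apply, ← RingHom.map_det]

/-- **`det γ = ±1`** for `γ ∈ GL_n(ℚ)` with `a⁻¹ γ a ≡ 1` and `(a⁻¹ γ a)⁻¹ ≡ 1 (mod N·ℤ̂)` (both are integral, so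
`det γ, det γ⁻¹ ∈ ℚ ∩ ℤ̂ = ℤ`). [cite: Deligne1971TravauxShimura, Exemple 4.16 p. 150] -/
theorem det_eq_one_or_eq_neg_one_of_isCongOne {N : ℕ} (γ : GL n ℚ) (a : GL n finAdeleQ)
    (hm : IsCongOne N ((a⁻¹ * Matrix.GeneralLinearGroup.map (algebraMap ℚ finAdeleQ) γ * a : GL n finAdeleQ) :
      Matrix n n finAdeleQ))
    (hm' : IsCongOne N (((a⁻¹ * Matrix.GeneralLinearGroup.map (algebraMap ℚ finAdeleQ) γ * a)⁻¹ : GL n finAdeleQ) :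
      Matrix n n finAdeleQ)) :
    (γ : Matrix n n ℚ).det = 1 ∨ (γ : Matrix n n ℚ).det = -1 := by
  set f := algebraMap ℚ finAdeleQ with hf
  have hinv : (a⁻¹ * Matrix.GeneralLinearGroup.map f γ * a)⁻¹ = a⁻¹ * Matrix.GeneralLinearGroup.map f γ⁻¹ * a := by
    rw [map_inv]; group
  obtain ⟨z, hz⟩ := exists_int_cast_eq_of_algebraMap_mem_integralAdeles
    (show f (γ : Matrix n n ℚ).det ∈ _ by
      rw [← det_conj_map γ a]; exact det_mem_integralAdeles (mem_integralAdeles_of_isCongOne hm))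
  obtain ⟨w, hw⟩ := exists_int_cast_eq_of_algebraMap_mem_integralAdeles
    (show f ((γ⁻¹ : GL n ℚ) : Matrix n n ℚ).det ∈ _ by
      rw [← det_conj_map γ⁻¹ a, ← hinv]; exact det_mem_integralAdeles (mem_integralAdeles_of_isCongOne hm'))
  have hzw : z * w = 1 := by
    have : (z : ℚ) * w = 1 := by
      rw [hz, hw, ← Matrix.det_mul, ← Units.val_mul, mul_inv_cancel, Units.val_one, Matrix.det_one]
    exact_mod_cast this
  rcases Int.eq_one_or_neg_one_of_mul_eq_one hzw with h | h
  · left; rw [← hz, h, Int.cast_one]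
  · right; rw [← hz, h, Int.cast_neg, Int.cast_one]

/-! ### §2. Freeness of `K_δ(N)/K_δ(N′)` on the Siegel Shimura set at principal level `N′` -/

/-- Real-side bookkeeping: for `γ ∈ GSp_δ(ℚ)` stabilising `J ∈ S^±` (`γ J γ⁻¹ = J`) there are a POSITIVE DEFINITE real
symmetric `S` (`= ±ᵗJ E_δ`) and the multiplier `ν ∈ ℚ` of `γ` with `ᵗγ S γ = ν S` and `0 < ν`. [cite: Milne2005ShimuraVarieties, §6 p. 68 and Prop. 3.5] -/
private theorem exists_posDef_smul_of_conjAct_eq [Nonempty (Fin g ⊕ Fin g)] {δ : Fin g → ℕ} (γ : gspRational δ) (J : C0pm δ)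
    (hJ : conjAct δ (gspRationalToReal δ γ) J = J) :
    ∃ (S : Matrix (Fin g ⊕ Fin g) (Fin g ⊕ Fin g) ℝ) (ν : ℚ), S.PosDef ∧ 0 < ν ∧
      (((γ : GL (Fin g ⊕ Fin g) ℚ) : Matrix (Fin g ⊕ Fin g) (Fin g ⊕ Fin g) ℚ).map (algebraMap ℚ ℝ))ᵀ * S *
        (((γ : GL (Fin g ⊕ Fin g) ℚ) : Matrix (Fin g ⊕ Fin g) (Fin g ⊕ Fin g) ℚ).map (algebraMap ℚ ℝ)) = (ν : ℝ) • S := by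
  set M : Matrix (Fin g ⊕ Fin g) (Fin g ⊕ Fin g) ℝ :=
    (((γ : GL (Fin g ⊕ Fin g) ℚ) : Matrix (Fin g ⊕ Fin g) (Fin g ⊕ Fin g) ℚ).map (algebraMap ℚ ℝ)) with hM
  have hMcoe : ((gspRationalToReal δ γ : gspReal δ) : GL (Fin g ⊕ Fin g) ℝ) = Matrix.GeneralLinearGroup.map (algebraMap ℚ ℝ) γ :=
    coe_gspRationalToReal δ γ
  have hMval : ((Matrix.GeneralLinearGroup.map (algebraMap ℚ ℝ) (γ : GL (Fin g ⊕ Fin g) ℚ) : GL (Fin g ⊕ Fin g) ℝ) :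
      Matrix (Fin g ⊕ Fin g) (Fin g ⊕ Fin g) ℝ) = M :=
    Matrix.ext fun i j => Matrix.GeneralLinearGroup.map_apply (algebraMap ℚ ℝ) i j _
  -- `M J = J M`
  have hcomm : M * (J : Matrix (Fin g ⊕ Fin g) (Fin g ⊕ Fin g) ℝ) = (J : Matrix (Fin g ⊕ Fin g) (Fin g ⊕ Fin g) ℝ) * M := by
    have h1 := congrArg (fun X : C0pm δ => (X : Matrix (Fin g ⊕ Fin g) (Fin g ⊕ Fin g) ℝ)) hJ
    simp only [coe_conjAct, conjJ_def, hMcoe] at h1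
    have h2 := congrArg (fun X => X * M) h1
    rw [Matrix.mul_assoc, ← hMval, Matrix.coe_units_inv, Matrix.nonsing_inv_mul _ (Matrix.isUnits_det_units _), Matrix.mul_one]
      at h2
    rw [← hMval]; exact h2
  -- the multiplier of `γ`
  obtain ⟨ν, hν⟩ := mem_similitudeGroupOfForm_iff.1 γ.2
  have hνR : Mᵀ * realTypeForm δ * M = ((ν : ℚ) : ℝ) • realTypeForm δ := by
    have h := congrArg (fun X : Matrix (Fin g ⊕ Fin g) (Fin g ⊕ Fin g) ℚ => X.map (algebraMap ℚ ℝ)) hν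
    rw [Matrix.map_mul, Matrix.map_mul, Matrix.transpose_map, typeFormOver_map,
      Matrix.map_smul' _ _ _ (map_mul (algebraMap ℚ ℝ)), typeFormOver_map, typeFormOver_real_eq_realTypeForm,
      eq_ratCast] at h
    rw [hM]
    exact h
  -- `ᵗM (ᵗJ E) M = ν ᵗJ E`
  have hT : Mᵀ * ((J : Matrix _ _ ℝ)ᵀ * realTypeForm δ) * M = ((ν : ℚ) : ℝ) • ((J : Matrix _ _ ℝ)ᵀ * realTypeForm δ) := by
    calc Mᵀ * ((J : Matrix _ _ ℝ)ᵀ * realTypeForm δ) * M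
        = ((J : Matrix _ _ ℝ) * M)ᵀ * realTypeForm δ * M := by simp only [Matrix.transpose_mul, Matrix.mul_assoc]
      _ = (M * (J : Matrix _ _ ℝ))ᵀ * realTypeForm δ * M := by rw [hcomm]
      _ = (J : Matrix _ _ ℝ)ᵀ * (Mᵀ * realTypeForm δ * M) := by
          simp only [Matrix.transpose_mul, Matrix.mul_assoc]
      _ = ((ν : ℚ) : ℝ) • ((J : Matrix _ _ ℝ)ᵀ * realTypeForm δ) := by rw [hνR, Matrix.mul_smul]
  -- a positive definite `S = ± ᵗJ E` with `ᵗM S M = ν S`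
  obtain ⟨S, hS, hMS⟩ : ∃ S : Matrix (Fin g ⊕ Fin g) (Fin g ⊕ Fin g) ℝ, S.PosDef ∧ Mᵀ * S * M = ((ν : ℚ) : ℝ) • S := by
    rcases J.2 with h | h
    · exact ⟨_, (mem_C0_iff.1 h).2, hT⟩
    · refine ⟨(-(J : Matrix _ _ ℝ))ᵀ * realTypeForm δ, (mem_C0_iff.1 h).2, ?_⟩
      rw [Matrix.transpose_neg, Matrix.neg_mul, Matrix.mul_neg, Matrix.neg_mul, hT, smul_neg]
  -- `ν > 0`: evaluate at a non-zero vector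
  have hνpos : (0 : ℝ) < ((ν : ℚ) : ℝ) := by
    obtain ⟨i⟩ := (inferInstance : Nonempty (Fin g ⊕ Fin g))
    set x : Fin g ⊕ Fin g → ℝ := Pi.single i 1 with hx
    have hx0 : x ≠ 0 := by
      intro h; have := congrFun h i; simp [hx] at this
    have hMx : M *ᵥ x ≠ 0 := by
      intro h
      have hdet : IsUnit M.det := by rw [← hMval]; exact Matrix.isUnits_det_units _
      have hMu : IsUnit M := (Matrix.isUnit_iff_isUnit_det M).2 hdet
      exact hx0 ((Matrix.mulVec_injective_iff_isUnit.2 hMu) (by rw [h, Matrix.mulVec_zero]))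
    have h1 : (M *ᵥ x) ⬝ᵥ (S *ᵥ (M *ᵥ x)) = ((ν : ℚ) : ℝ) * (x ⬝ᵥ (S *ᵥ x)) := by
      rw [Matrix.mulVec_mulVec, Matrix.dotProduct_mulVec, Matrix.vecMul_mulVec, ← Matrix.mul_assoc, hMS,
        ← Matrix.dotProduct_mulVec, Matrix.smul_mulVec, dotProduct_smul, smul_eq_mul]
    have h2 := hS.dotProduct_mulVec_pos hMx
    have h3 := hS.dotProduct_mulVec_pos hx0
    rw [star_trivial] at h2 h3
    rw [h1] at h2
    exact pos_of_mul_pos_left h2 h3.le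
  exact ⟨S, ν, hS, by exact_mod_cast hνpos, hMS⟩

/-- **FREENESS AT PRINCIPAL LEVEL** ([Deligne 1971] proof of 1.15; [Milne ISV] Thm. 5.17): for `N ≥ 3`, `N ∣ N′`,
`κ ∈ K_δ(N)`, and a point `[J, a]` of the Siegel Shimura set at principal level `K_δ(N′)`:
`[J, a·κ] = [J, a] ⟹ κ ∈ K_δ(N′)`.  So `K_δ(N)/K_δ(N′)` acts freely on `Sh_{K_δ(N′)}(GSp_δ, S^±)(ℂ)`.
Proof: `γ ∈ GSp_δ(ℚ)` with `γJγ⁻¹ = J` and `a⁻¹γa ∈ κK_δ(N′) ⊆ K_δ(N)` is a rational isometry (`ν = 1` from `ν > 0`,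
`ν^{2g} = det γ² = 1`) of the definite `±ᵗJ E_δ` with `charpoly((γ-1)/N) ∈ ℤ[X]`, hence `γ = 1`
(★ `eq_one_of_isometry_of_charpoly_integral`). [cite: Deligne1971TravauxShimura, proof of Prop. 1.15 p. 132]
[cite: Milne2005ShimuraVarieties, Thm. 5.17 (proof) and Prop. 3.5] -/
theorem mem_principalLevelSubgroup_of_mk_mul_eq_mk {δ : Fin g → ℕ} {N N' : ℕ} (hN : 3 ≤ N) (hNN' : N ∣ N')
    {κ : gspFinAdelic δ} (hκ : κ ∈ principalLevelSubgroup δ N) (J : C0pm δ) (a : gspFinAdelic δ)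
    (h : SiegelShimuraSet.mk δ (principalLevelSubgroup δ N') J (a * κ) = SiegelShimuraSet.mk δ (principalLevelSubgroup δ N') J a) :
    κ ∈ principalLevelSubgroup δ N' := by
  obtain ⟨γ, hJ, hq⟩ := (SiegelShimuraSet.mk_eq_mk_iff δ _ J J (a * κ) a).1 h
  -- the coset relation: `k := (γ a)⁻¹ (a κ) ∈ K_δ(N′)` and `a⁻¹ γ a = κ k⁻¹ ∈ K_δ(N)`
  have hk : (gspRationalToFinAdelic δ γ * a)⁻¹ * (a * κ) ∈ principalLevelSubgroup δ N' := by
    rw [← QuotientGroup.eq]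
    rw [MulAction.Quotient.smul_mk] at hq
    exact hq
  -- it suffices to show `γ = 1`
  suffices hγ : γ = 1 by
    rw [hγ, map_one, one_mul, ← mul_assoc, inv_mul_cancel, one_mul] at hk
    exact hk
  set m : gspFinAdelic δ := a⁻¹ * gspRationalToFinAdelic δ γ * a with hmdef
  have hm_eq : m = κ * ((gspRationalToFinAdelic δ γ * a)⁻¹ * (a * κ))⁻¹ := by rw [hmdef]; group
  have hmN : m ∈ principalLevelSubgroup δ N := by
    rw [hm_eq]
    exact mul_mem hκ (inv_mem (principalLevelSubgroup_anti δ hNN' hk))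
  -- in `GL_{2g}(𝔸_f)`: `m = a⁻¹ γ_𝔸 a`
  have hmGL : (m : GL (Fin g ⊕ Fin g) finAdeleQ) =
      (a : GL (Fin g ⊕ Fin g) finAdeleQ)⁻¹ * Matrix.GeneralLinearGroup.map (algebraMap ℚ finAdeleQ) (γ : GL (Fin g ⊕ Fin g) ℚ) *
        (a : GL (Fin g ⊕ Fin g) finAdeleQ) := by
    rw [hmdef, Subgroup.coe_mul, Subgroup.coe_mul, Subgroup.coe_inv, coe_gspRationalToFinAdelic]
  have hcong := (mem_principalLevelSubgroup_iff δ).1 hmN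
  rw [hmGL] at hcong
  -- the two arithmetic inputs
  have hP := exists_monic_map_eq_charpoly_of_isCongOne (by omega : N ≠ 0) (γ : GL (Fin g ⊕ Fin g) ℚ) a hcong.1
  have hdet := det_eq_one_or_eq_neg_one_of_isCongOne (γ : GL (Fin g ⊕ Fin g) ℚ) a hcong.1 hcong.2
  -- the empty case `g = 0`
  rcases isEmpty_or_nonempty (Fin g ⊕ Fin g) with hempty | hne
  · apply Subtype.ext; apply Units.ext
    exact Subsingleton.elim _ _
  -- the real side: a definite `S` with `ᵗγ S γ = ν S`, `ν > 0`
  obtain ⟨S, ν, hS, hνpos, hMS⟩ := exists_posDef_smul_of_conjAct_eq γ J hJ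
  set M : Matrix (Fin g ⊕ Fin g) (Fin g ⊕ Fin g) ℝ :=
    (((γ : GL (Fin g ⊕ Fin g) ℚ) : Matrix (Fin g ⊕ Fin g) (Fin g ⊕ Fin g) ℚ).map (algebraMap ℚ ℝ)) with hM
  -- `ν = 1`: `det M = ±1` and `det(ᵗM S M) = det M ² det S = ν^{2g} det S`
  have hν1 : ν = 1 := by
    have hdetM : M.det ^ 2 = 1 := by
      have : M.det = algebraMap ℚ ℝ (((γ : GL (Fin g ⊕ Fin g) ℚ) : Matrix (Fin g ⊕ Fin g) (Fin g ⊕ Fin g) ℚ).det) := by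
        rw [hM, ← RingHom.mapMatrix_apply, ← RingHom.map_det]
      rw [this]
      rcases hdet with h1 | h1 <;> rw [h1] <;> simp
    have h1 := congrArg Matrix.det hMS
    rw [Matrix.det_mul, Matrix.det_mul, Matrix.det_transpose, Matrix.det_smul, mul_comm (M.det), mul_assoc, ← sq,
      hdetM, mul_one] at h1
    have hdetS : S.det ≠ 0 := hS.det_pos.ne'
    have h2 : ((ν : ℚ) : ℝ) ^ Fintype.card (Fin g ⊕ Fin g) = 1 := by
      have := mul_right_cancel₀ hdetS (h1.symm.trans (one_mul S.det).symm)
      exact this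
    have hcard : Fintype.card (Fin g ⊕ Fin g) ≠ 0 := Fintype.card_ne_zero
    have : ((ν : ℚ) : ℝ) = 1 := (pow_eq_one_iff_of_nonneg (by exact_mod_cast hνpos.le) hcard).1 h2
    exact_mod_cast this
  rw [hν1, Rat.cast_one, one_smul] at hMS
  -- conclude with the rigidity theorem
  have hγ1 : ((γ : GL (Fin g ⊕ Fin g) ℚ) : Matrix (Fin g ⊕ Fin g) (Fin g ⊕ Fin g) ℚ) = 1 :=
    eq_one_of_isometry_of_charpoly_integral hS hMS hN hP
  apply Subtype.ext; apply Units.ext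
  rw [hγ1]; rfl

end Literature.AlgebraicGeometry.ModuliOfAbelianVarieties

end
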